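import Literature.NumberTheory.GaloisRepresentations.LubinTateColemanTwoVariableTransformTwo
import Literature.NumberTheory.GaloisRepresentations.LubinTateColemanTwoVariableCokernelTwo
import HarnessLib

/-!
# The cokernel of the two-variable Coleman transform is CYCLIC over `𝒪_F` (de Shalit I §3.8 (17): `0 → 𝒰 ⊗̂ 𝒪 → Λ(𝒢, 𝒪) → 𝒪(1) → 0`),
# in transform currency along a `ℤ_p`-tower `[E_m : F] = p^m` at `q = 2` (the unindexed twin of `LubinTateColemanTwoVariableCokernelCyclicTwo`)

De Shalit, *Iwasawa theory of elliptic curves with complex multiplication* (1987), Ch. I §3.7 Theorem and §3.8 (17), Ch. III §1.3, §1.10.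
The tree has the three ingredients of the limit sequence (17) for ANY tower of finite Galois unramified layers (`LubinTateColemanTwoVariable
LimitTwo`: image = trace-coherent series families with `r_m(0) ∈ (1 − uφ)𝒪_{E_m}`; `…CokernelTwo`: `lim←_m 𝒪_{E_m}/(1 − uφ)𝒪_{E_m}` is
generated by ONE family over `𝒪_F`; `exists_traceCoherent_series_lift`: Mittag-Leffler) and, for a `ℤ_p`-tower `[E_m : F] = p^m`, the
transform `Col : 𝒰_∞ → 𝒪_F⟦X⟧⟦Y⟧` (`LubinTateColemanTwoVariableTransformTwo`; the case `d = 1` of the two-variable towers, e.g. `𝔤 = 1` over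
`K = ℚ(√−7)`).  This file PACKAGES them into the statement the `Λ₂`-side consumes (the `ℤ/d`-indexed version for general unramified towers is
`LubinTateColemanTwoVariableCokernelCyclicTwo`):

* `isTransform_sub`, `isTransform_C_mul` — the transform congruences are `𝒪_F`-linear in (family, transform);
* ★ `existsUnique_traceCoherent_series_of_series` — every `G ∈ 𝒪_F⟦X⟧⟦Y⟧` is the transform of a UNIQUE trace-coherent family of series
  (coefficientwise `existsUnique_traceCoherent_of_series`): the transform is a BIJECTION `lim←_{Tr} 𝒪_{E_m}⟦Y⟧ ≅ 𝒪_F⟦X⟧⟦Y⟧`;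
* ★★★ `exists_cokernel_generator_colemanTransform₂` — **there is ONE `G₀ ∈ 𝒪_F⟦X⟧⟦Y⟧` such that for EVERY `G` there are a scalar `a ∈ 𝒪_F` and
  a baseNorm-coherent family `β` of PRINCIPAL norm-coherent units with `Col(β) = G − a·G₀`**: the target of the (injective,
  `eq_of_colemanTransform₂_eq`; equivariant, `…TwistGaloisTwo`) two-variable Coleman transform is `Col(𝒰¹_∞) + 𝒪_F·G₀` — de Shalit's cokernel
  `𝒪(1)`, cyclic over `𝒪_F`, hence finitely generated over the coefficients and PSEUDO-NULL over any two-dimensional Iwasawa algebra acting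
  compatibly: for characteristic ideals `𝒰¹_∞` may be replaced by `𝒪_F⟦X⟧⟦Y⟧ = Λ·1 ⊕ Λ·σ_{−1}(1)`, `Λ = 𝒪_F⟦X⟧⟦T⟧`
  (`LubinTateColemanCoordDeltaTwoVariable`).

Hypotheses: `char F = 0`, `q = 2`, `π = 2u` with `u^{[E_m:F]} ≠ 1` for all `m` (finite anomaly indices), `π ≡ m₁ (mod π²)` for some `m₁ ∈ ℕ`
(automatic for `F = ℚ₂`), `𝒪_F` `(p)`-complete with `p` not a unit.  Everything PROVED (0 sorry, no named facts, no new definitions).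

## References

* E. de Shalit, *Iwasawa theory of elliptic curves with complex multiplication* (1987), Ch. I §3.7–3.8 (17); Ch. III §1.3, §1.10. [deShalit1987]
-/

noncomputable section

open scoped PowerSeries.WithPiTopology

namespace Literature.NumberTheory.GaloisRepresentations

section TwoVariableCokernelGeneratorTwo

open GaloisRepresentations.IsNonarchimedeanLocalField LubinTate ValuativeRel Field Finset
open Literature.NumberTheory.EllipticCurves.IwasawaOmega

variable {F : Type} [Field F] [ValuativeRel F] [TopologicalSpace F] [IsNonarchimedeanLocalField F]

attribute [local instance] ltNormUniformSpace ltNormIsUniformAddGroup rk1 nF nE fintypeResidueField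

variable (p : ℕ) [hp : Fact p.Prime]
variable {π : 𝒪[F]} (hπ : (valuation F).IsUniformizer (π : F))
variable (E : ℕ → IntermediateField F (AlgebraicClosure F)) [∀ m, FiniteDimensional F (E m)] [∀ m, Normal F (E m)]
  [∀ m, IsGalois F (E m)] (hmono : Monotone E) (hE : ∀ m, E m ≤ maxUnramified F) (hdeg : ∀ m, Module.finrank F (E m) = p ^ m)
  {σ₀ : absoluteGaloisGroup F} (hσ₀ : IsAbsArithFrob σ₀)

/-! ### Linearity of the transform congruences -/

/-- **The transform congruences are compatible with subtraction.** [cite: deShalit1987, Ch. I §3.8 (17)] -/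
theorem isTransform_sub {θ : ∀ m, unitBall (E m)} (hθ : ∀ m, IsIntegralNormalGen (E m) (θ m))
    {r r' : ∀ m, PowerSeries (unitBall (E m))} {G G' : PowerSeries (PowerSeries 𝒪[F])}
    (hG : ∀ m k, ((1 + PowerSeries.X : PowerSeries 𝒪[F]) ^ p ^ m - 1) ∣
      PowerSeries.coeff k G - ∑ i : ZMod (p ^ m), PowerSeries.C ((hθ m).basis.repr (PowerSeries.coeff k (r m))
        (((absoluteGaloisGroup.toAlgEquiv F σ₀).restrictNormal (E m)) ^ i.val)) *
          (1 + PowerSeries.X) ^ i.val)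
    (hG' : ∀ m k, ((1 + PowerSeries.X : PowerSeries 𝒪[F]) ^ p ^ m - 1) ∣
      PowerSeries.coeff k G' - ∑ i : ZMod (p ^ m), PowerSeries.C ((hθ m).basis.repr (PowerSeries.coeff k (r' m))
        (((absoluteGaloisGroup.toAlgEquiv F σ₀).restrictNormal (E m)) ^ i.val)) *
          (1 + PowerSeries.X) ^ i.val) (m k : ℕ) :
    ((1 + PowerSeries.X : PowerSeries 𝒪[F]) ^ p ^ m - 1) ∣
      PowerSeries.coeff k (G - G') - ∑ i : ZMod (p ^ m), PowerSeries.C ((hθ m).basis.repr (PowerSeries.coeff k (r m - r' m))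
        (((absoluteGaloisGroup.toAlgEquiv F σ₀).restrictNormal (E m)) ^ i.val)) *
          (1 + PowerSeries.X) ^ i.val := by
  have e : PowerSeries.coeff k (G - G') - ∑ i : ZMod (p ^ m), PowerSeries.C ((hθ m).basis.repr (PowerSeries.coeff k (r m - r' m))
        (((absoluteGaloisGroup.toAlgEquiv F σ₀).restrictNormal (E m)) ^ i.val)) *
          (1 + PowerSeries.X) ^ i.val =
      (PowerSeries.coeff k G - ∑ i : ZMod (p ^ m), PowerSeries.C ((hθ m).basis.repr (PowerSeries.coeff k (r m))
        (((absoluteGaloisGroup.toAlgEquiv F σ₀).restrictNormal (E m)) ^ i.val)) *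
          (1 + PowerSeries.X) ^ i.val) -
      (PowerSeries.coeff k G' - ∑ i : ZMod (p ^ m), PowerSeries.C ((hθ m).basis.repr (PowerSeries.coeff k (r' m))
        (((absoluteGaloisGroup.toAlgEquiv F σ₀).restrictNormal (E m)) ^ i.val)) *
          (1 + PowerSeries.X) ^ i.val) := by
    rw [map_sub, map_sub, map_sub, sub_sub_sub_comm, ← sum_sub_distrib]
    refine congrArg _ (sum_congr rfl fun i _ => ?_)
    rw [Finsupp.sub_apply, map_sub, sub_mul]
  rw [e]
  exact dvd_sub (hG m k) (hG' m k)

/-- **The transform congruences are compatible with `𝒪_F`-scalars**: if `G` is a transform of `r` then `C(C a)·G` is a transform of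
`(C(a)·r_m)_m` (`a ∈ 𝒪_F` read in `𝒪_{E_m}`). [cite: deShalit1987, Ch. I §3.8 (17)] -/
theorem isTransform_C_mul {θ : ∀ m, unitBall (E m)} (hθ : ∀ m, IsIntegralNormalGen (E m) (θ m))
    {r : ∀ m, PowerSeries (unitBall (E m))} {G : PowerSeries (PowerSeries 𝒪[F])}
    (hG : ∀ m k, ((1 + PowerSeries.X : PowerSeries 𝒪[F]) ^ p ^ m - 1) ∣
      PowerSeries.coeff k G - ∑ i : ZMod (p ^ m), PowerSeries.C ((hθ m).basis.repr (PowerSeries.coeff k (r m))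
        (((absoluteGaloisGroup.toAlgEquiv F σ₀).restrictNormal (E m)) ^ i.val)) *
          (1 + PowerSeries.X) ^ i.val) (a : 𝒪[F]) (m k : ℕ) :
    ((1 + PowerSeries.X : PowerSeries 𝒪[F]) ^ p ^ m - 1) ∣
      PowerSeries.coeff k (PowerSeries.C (PowerSeries.C a) * G) - ∑ i : ZMod (p ^ m), PowerSeries.C ((hθ m).basis.repr
        (PowerSeries.coeff k (PowerSeries.C (algebraMap 𝒪[F] (unitBall (E m)) a) * r m))
        (((absoluteGaloisGroup.toAlgEquiv F σ₀).restrictNormal (E m)) ^ i.val)) *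
          (1 + PowerSeries.X) ^ i.val := by
  have e : PowerSeries.coeff k (PowerSeries.C (PowerSeries.C a) * G) - ∑ i : ZMod (p ^ m), PowerSeries.C ((hθ m).basis.repr
        (PowerSeries.coeff k (PowerSeries.C (algebraMap 𝒪[F] (unitBall (E m)) a) * r m))
        (((absoluteGaloisGroup.toAlgEquiv F σ₀).restrictNormal (E m)) ^ i.val)) *
          (1 + PowerSeries.X) ^ i.val =
      PowerSeries.C a * (PowerSeries.coeff k G - ∑ i : ZMod (p ^ m), PowerSeries.C ((hθ m).basis.repr (PowerSeries.coeff k (r m))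
        (((absoluteGaloisGroup.toAlgEquiv F σ₀).restrictNormal (E m)) ^ i.val)) *
          (1 + PowerSeries.X) ^ i.val) := by
    rw [PowerSeries.coeff_C_mul, PowerSeries.coeff_C_mul, ← Algebra.smul_def, map_smul, mul_sub, mul_sum]
    refine congrArg _ (sum_congr rfl fun i _ => ?_)
    rw [Finsupp.smul_apply, smul_eq_mul, map_mul, mul_assoc]
  rw [e]
  exact Dvd.dvd.mul_left (hG m k) _

/-! ### The transform is a bijection `lim←_{Tr} 𝒪_{E_m}⟦Y⟧ ≅ (𝒪_F⟦X⟧⟦Y⟧)^{ℤ/d}` -/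

include hE hdeg hσ₀ in
/-- ★ **Every `G ∈ 𝒪_F⟦X⟧⟦Y⟧` is the transform of a UNIQUE trace-coherent family of series** (coefficientwise
`existsUnique_traceCoherent_of_series`). [cite: deShalit1987, Ch. I §3.8 (17)] -/
theorem existsUnique_traceCoherent_series_of_series [IsAdicComplete (Ideal.span {(p : 𝒪[F])}) 𝒪[F]]
    (hI : Ideal.span {(p : 𝒪[F])} ≠ ⊤) {θ : ∀ m, unitBall (E m)} (hθ : ∀ m, IsIntegralNormalGen (E m) (θ m))
    (hcoh : ∀ m, unitBallTrace (hmono (Nat.le_succ m)) (θ (m + 1)) = θ m) (G : PowerSeries (PowerSeries 𝒪[F])) :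
    ∃! r : ∀ m, PowerSeries (unitBall (E m)),
      (∀ m k, unitBallTrace (hmono (Nat.le_succ m)) (PowerSeries.coeff k (r (m + 1))) = PowerSeries.coeff k (r m)) ∧
      ∀ m k, ((1 + PowerSeries.X : PowerSeries 𝒪[F]) ^ p ^ m - 1) ∣
        PowerSeries.coeff k G - ∑ i : ZMod (p ^ m), PowerSeries.C ((hθ m).basis.repr (PowerSeries.coeff k (r m))
          (((absoluteGaloisGroup.toAlgEquiv F σ₀).restrictNormal (E m)) ^ i.val)) *
            (1 + PowerSeries.X) ^ i.val := by
  have hk := fun k => existsUnique_traceCoherent_of_series p E hmono hE hdeg hσ₀ hI hθ hcoh (PowerSeries.coeff k G)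
  choose x hx using fun k => (hk k).exists
  refine ⟨fun m => PowerSeries.mk fun k => x k m, ⟨fun m k => ?_, fun m k => ?_⟩, ?_⟩
  · rw [PowerSeries.coeff_mk, PowerSeries.coeff_mk]; exact (hx k).1 m
  · rw [PowerSeries.coeff_mk]; exact (hx k).2 m
  · rintro r ⟨hr, hrG⟩
    funext m
    refine PowerSeries.ext fun k => ?_
    rw [PowerSeries.coeff_mk]
    exact congrFun ((hk k).unique ⟨fun m' => hr m' k, fun m' => hrG m' k⟩ (hx k)) m

/-! ### The cokernel of `Col` is cyclic over `𝒪_F` -/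

variable (hq : residueFieldCard F = 2)

include hdeg in
set_option maxHeartbeats 400000 in
/-- ★★★ **The cokernel of the two-variable Coleman transform is cyclic over `𝒪_F`** (de Shalit's `𝒪(1)` in (17)): there is ONE
`G₀ ∈ 𝒪_F⟦X⟧⟦Y⟧` such that for EVERY `G ∈ 𝒪_F⟦X⟧⟦Y⟧` there are `a ∈ 𝒪_F` and a baseNorm-coherent family `β = (β_m)_m` of PRINCIPAL norm-coherent
units of the two-variable tower whose transform is `G − a·G₀` — i.e. `𝒪_F⟦X⟧⟦Y⟧ = Col(𝒰¹_∞) + 𝒪_F·G₀`.  Proof: `G` is the transform of a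
trace-coherent series family `r` (`existsUnique_traceCoherent_series_of_series`); the constant coefficients `r_m(0)` form a
family coherent modulo the `(1 − uφ)𝒪_{E_m}`, hence `≡ a·g_m` for the universal generator `g` of `exists_generator_cokernel_limit`; lifting `g`
to a trace-coherent series family `r₀` (`exists_traceCoherent_series_lift`, transform `G₀`), the family `r − a·r₀` has constant coefficients in
the `(1 − uφ)𝒪_{E_m}`, so it is the coordinate family of a principal `β` (`exists_baseNormCoherent_principal_iff`), whose transform is `G − a·G₀`
by linearity. [cite: deShalit1987, Ch. I §3.7–3.8 (17); Ch. III §1.3] -/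
theorem exists_cokernel_generator_colemanTransform₂ [CharZero F] [IsAdicComplete (Ideal.span {(p : 𝒪[F])}) 𝒪[F]]
    (hI : Ideal.span {(p : 𝒪[F])} ≠ ⊤) {θ : ∀ m, unitBall (E m)} (hθ : ∀ m, IsIntegralNormalGen (E m) (θ m))
    (hcoh : ∀ m, unitBallTrace (hmono (Nat.le_succ m)) (θ (m + 1)) = θ m) (u : (LTCoeff F)ˣ) (hu : LTCoeff.of F π = residueFieldCard F * u)
    (hm : ∃ m₁ : ℕ, LTCoeff.of F π ^ 2 ∣ LTCoeff.of F π - m₁) (hud : ∀ m, (u : LTCoeff F) ^ Module.finrank F (E m) ≠ 1) :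
    ∃ G₀ : PowerSeries (PowerSeries 𝒪[F]), ∀ G : PowerSeries (PowerSeries 𝒪[F]),
      ∃ (a : 𝒪[F]) (β : ∀ m, RelNormCoherentUnits hπ (E m)),
        (∀ m, (β (m + 1)).baseNorm hπ (hmono (Nat.le_succ m)) = β m) ∧
        (∀ m, ‖(((β m).val 0 : unitBall (E m ⊔ ltField π 0 : IntermediateField F (AlgebraicClosure F))) :
          (E m ⊔ ltField π 0 : IntermediateField F (AlgebraicClosure F))) - 1‖ < 1) ∧
        ∀ m k, ((1 + PowerSeries.X : PowerSeries 𝒪[F]) ^ p ^ m - 1) ∣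
          PowerSeries.coeff k (G - PowerSeries.C (PowerSeries.C a) * G₀) - ∑ i : ZMod (p ^ m), PowerSeries.C ((hθ m).basis.repr
            (PowerSeries.coeff k (relUnitCoordTwo hπ (E m) hq (hE m) hσ₀ u hu (β m)))
            (((absoluteGaloisGroup.toAlgEquiv F σ₀).restrictNormal (E m)) ^ i.val)) *
              (1 + PowerSeries.X) ^ i.val := by
  classical
  -- the scalar `u` in `𝒪_F`-currency
  set u' : 𝒪[F] := (LTCoeff.of F).symm (u : LTCoeff F) with hu'
  have hau : ∀ m, algebraMap (LTCoeff F) (unitBall (E m)) (u : LTCoeff F) = algebraMap 𝒪[F] (unitBall (E m)) u' := fun m =>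
    algebraMap_LTCoeff_eq_algebraMap (E m) (u : LTCoeff F)
  have hud' : ∀ m, 1 - u' ^ Module.finrank F (E m) ≠ 0 := fun m h => hud m (by
    have h' : u' ^ Module.finrank F (E m) = 1 := (sub_eq_zero.mp h).symm
    exact h')
  -- Step 1: the universal generator of `lim←_m 𝒪_{E_m}/(1 − uφ)𝒪_{E_m}`
  obtain ⟨g, hgcoh, hguniv⟩ := exists_generator_cokernel_limit hπ E hmono hE hσ₀ u' hud'
  -- Step 2: lift it to a trace-coherent family of series `r₀`
  obtain ⟨r₀, hr₀, hr₀g⟩ := exists_traceCoherent_series_lift (σ₀ := σ₀) E hmono (u : LTCoeff F) g fun m => by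
    obtain ⟨e, he⟩ := hgcoh m
    exact ⟨e, by rw [hau m]; exact he⟩
  -- Step 3: its transform `G₀`
  obtain ⟨G₀, hG₀⟩ := (existsUnique_series_amice_of_traceCoherent p E hmono hE hdeg hσ₀ hθ hcoh r₀ hr₀).exists
  refine ⟨G₀, fun G => ?_⟩
  -- Step 4: `G` is the transform of a trace-coherent family `r`
  obtain ⟨r, ⟨hr, hrG⟩, -⟩ := existsUnique_traceCoherent_series_of_series p E hmono hE hdeg hσ₀ hI hθ hcoh G
  -- Step 5: the scalar `a` with `r_m(0) ≡ a·g_m (mod (1 − uφ)𝒪_{E_m})`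
  obtain ⟨a, ha⟩ := hguniv (fun m => PowerSeries.constantCoeff (r m)) fun m => ⟨0, by
    rw [map_zero, mul_zero, sub_zero, ← PowerSeries.coeff_zero_eq_constantCoeff_apply, ← PowerSeries.coeff_zero_eq_constantCoeff_apply,
      hr m 0, sub_self]⟩
  -- Step 6: the corrected family `r − a·r₀` has constant coefficients in the `(1 − uφ)𝒪_{E_m}`
  have hφa : ∀ m (y : unitBall (E m)), (frobUnitBall (E m) σ₀ : unitBall (E m) →+* unitBall (E m)) (a • y) =
      a • (frobUnitBall (E m) σ₀ : unitBall (E m) →+* unitBall (E m)) y := fun m y => unitBallEquiv_smul (E m) _ a y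
  have hconst : ∀ m, ∃ c : unitBall (E m), PowerSeries.constantCoeff (r m - PowerSeries.C (algebraMap 𝒪[F] (unitBall (E m)) a) * r₀ m) =
      c - algebraMap (LTCoeff F) (unitBall (E m)) u * (frobUnitBall (E m) σ₀ : unitBall (E m) →+* unitBall (E m)) c := by
    intro m
    obtain ⟨d₁, hd₁⟩ := ha m
    obtain ⟨d₂, hd₂⟩ := hr₀g m
    refine ⟨d₁ - a • d₂, ?_⟩
    have e1 : PowerSeries.constantCoeff (r m - PowerSeries.C (algebraMap 𝒪[F] (unitBall (E m)) a) * r₀ m) =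
        (PowerSeries.constantCoeff (r m) - a • g m) - a • (PowerSeries.constantCoeff (r₀ m) - g m) := by
      rw [map_sub, map_mul, PowerSeries.constantCoeff_C, ← Algebra.smul_def, smul_sub]; abel
    have hd₂' : PowerSeries.constantCoeff (r₀ m) - g m =
        d₂ - algebraMap 𝒪[F] (unitBall (E m)) u' * (frobUnitBall (E m) σ₀ : unitBall (E m) →+* unitBall (E m)) d₂ := by
      rw [← hau m]; exact hd₂
    rw [e1, hd₁, hd₂', hau m, map_sub, hφa, smul_sub, mul_sub, mul_smul_comm]
    abel
  -- Step 7: hence it is the coordinate family of a baseNorm-coherent family of principal units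
  have hr' : ∀ m k, unitBallTrace (hmono (Nat.le_succ m))
      (PowerSeries.coeff k (r (m + 1) - PowerSeries.C (algebraMap 𝒪[F] (unitBall (E (m + 1))) a) * r₀ (m + 1))) =
      PowerSeries.coeff k (r m - PowerSeries.C (algebraMap 𝒪[F] (unitBall (E m)) a) * r₀ m) := fun m k => by
    rw [map_sub, PowerSeries.coeff_C_mul, ← Algebra.smul_def, map_sub, map_smul, hr, hr₀, map_sub, PowerSeries.coeff_C_mul,
      ← Algebra.smul_def]
  obtain ⟨β, hβ, hβ1, hβr⟩ := (exists_baseNormCoherent_principal_iff hπ hq hσ₀ E hmono hE u hu hm hud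
    (fun m => r m - PowerSeries.C (algebraMap 𝒪[F] (unitBall (E m)) a) * r₀ m) hr').mpr hconst
  refine ⟨a, β, hβ, hβ1, fun m k => ?_⟩
  -- Step 8: its transform is `G − a·G₀` by linearity
  rw [hβr m]
  exact isTransform_sub p E hθ hrG (isTransform_C_mul p E hθ hG₀ a) m k

end TwoVariableCokernelGeneratorTwo

end Literature.NumberTheory.GaloisRepresentations
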